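import Mathlib
import HarnessLib
import Literature.Analysis.FluidPDE.ParasiticSlabFlow
import Summits.NavierStokesRegularity.NavierStokesRegularity.Theorems.PoloidalWindowRigidity.Negative.CellField
import Summits.NavierStokesRegularity.NavierStokesRegularity.Theorems.LrcModEntire.Negative.TwistedColumnField

/-!
# Item `LrcModEntire` (stmt-NavierStokesRegularity-20428) — negative side: the TWISTED (TH) COLUMN, III: the Type-I
# profile, proportional shear, vorticity, twist bracket and class data

Negative-side support (refuter seat ns-regularity-refuter1; D-0081 §C), continuing `…Negative.TwistedColumnField`:
`twistProfile t x = (−t)^{-1/2} V(x)` (`cellAmp` of `…PoloidalWindowRigidity.Negative.CellField`) with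
* the directional derivatives `∂₂ vₕ`, `∇ₕ v₂`, `∂₂ v₂` in closed form and the (TH) PROPORTIONAL SHEAR
  `∂₂ v_b = m(x₂) ∂_b v₂`, `b = 0, 1`, with the height-dependent, non-constant slope `m = twistSlope`
  (`twistProfile_timeHeightSlope`);
* `curl v(t) = (−t)^{-1/2} K` (`curl_twistProfile`), horizontal, and `D(curl v(t))` in closed form;
* the TWIST BRACKET `∂₀(∂₂v₂)·∂₁v₂ − ∂₁(∂₂v₂)·∂₀v₂ = −(−t)^{-1} sin x₀ sin x₁` (`twistProfile_twist`) — NON-ZERO off the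
  coordinate hyperplanes, by the Wronskian `P₁Q − Q₁P = −1`;
* the class data: (R) Type-I rate `10`, (C) joint continuity on the open backward slab, (D) divergence-free slices,
  (P) poloidal along `e₂`, (F) the frozen constraint.
The falsity theorems are in `…LrcModEntire.Negative.TwistingTHFalseWithoutMild`.
WHAT THIS IS NOT: not a claim about Navier–Stokes regularity — explicit vector calculus for a kinematic witness. [folklore]
-/

noncomputable section

-- the summit and its single sub-problem share the name (CONVENTIONS §1), as in every Theorems file
set_option linter.dupNamespace false

namespace Summit.NavierStokesRegularity.NavierStokesRegularity.Theorems.LrcModEntire.Negative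

open MeasureTheory Set Function Filter Topology Metric
open scoped RealInnerProductSpace InnerProductSpace
open Literature.Analysis Literature.Analysis.FluidPDE
open Summit.NavierStokesRegularity.NavierStokesRegularity.Theorems.PoloidalWindowRigidity.Negative

local notation "E3" => EuclideanSpace ℝ (Fin 3)
local notation "π" i => (EuclideanSpace.proj (𝕜 := ℝ) (i : Fin 3) : EuclideanSpace ℝ (Fin 3) →L[ℝ] ℝ)
local notation "𝐞" i => (EuclideanSpace.single (i : Fin 3) (1 : ℝ) : EuclideanSpace ℝ (Fin 3))

/-! ## The twisted column Type-I profile `v(t, x) = (−t)^{-1/2} V(x)` -/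

/-- `Dv(t) = (−t)^{-1/2} DV`. [folklore] -/
theorem fderiv_twistProfile (t : ℝ) (x : E3) : fderiv ℝ (twistProfile t) x = cellAmp t • twistDeriv x :=
  ((hasFDerivAt_twistField x).const_smul (cellAmp t)).fderiv

/-- `Dv(t)(x) w` in coordinates: `(−t)^{-1/2} (DV(x) w)ᵢ`. [folklore] -/
theorem fderiv_twistProfile_apply (t : ℝ) (x w : E3) (i : Fin 3) :
    fderiv ℝ (twistProfile t) x w i = cellAmp t * twistDeriv x w i := by
  rw [fderiv_twistProfile]; rfl

/-- `∂₂ v₀ = −(−t)^{-1/2} m P sin x₀`. [folklore] -/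
theorem fderiv_twistProfile_e2_apply_zero (t : ℝ) (x : E3) :
    fderiv ℝ (twistProfile t) x (𝐞 2) 0 = cellAmp t * (-(twistSlope (x 2) * twistP (x 2) * Real.sin (x 0))) := by
  rw [fderiv_twistProfile_apply, twistDeriv_apply_zero, show (𝐞 2) 0 = 0 by simp, show (𝐞 2) 2 = 1 by simp]
  ring

/-- `∂₂ v₁ = −(−t)^{-1/2} m Q sin x₁`. [folklore] -/
theorem fderiv_twistProfile_e2_apply_one (t : ℝ) (x : E3) :
    fderiv ℝ (twistProfile t) x (𝐞 2) 1 = cellAmp t * (-(twistSlope (x 2) * twistQ (x 2) * Real.sin (x 1))) := by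
  rw [fderiv_twistProfile_apply, twistDeriv_apply_one, show (𝐞 2) 1 = 0 by simp, show (𝐞 2) 2 = 1 by simp]
  ring

/-- `∂₂ v₂ = (−t)^{-1/2} (P₁ cos x₀ + Q₁ cos x₁)`. [folklore] -/
theorem fderiv_twistProfile_e2_apply_two (t : ℝ) (x : E3) :
    fderiv ℝ (twistProfile t) x (𝐞 2) 2 =
      cellAmp t * (twistP₁ (x 2) * Real.cos (x 0) + twistQ₁ (x 2) * Real.cos (x 1)) := by
  rw [fderiv_twistProfile_apply, twistDeriv_apply_two, show (𝐞 2) 0 = 0 by simp, show (𝐞 2) 1 = 0 by simp,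
    show (𝐞 2) 2 = 1 by simp]
  ring

/-- `∂₀ v₂ = −(−t)^{-1/2} P sin x₀`. [folklore] -/
theorem fderiv_twistProfile_e0_apply_two (t : ℝ) (x : E3) :
    fderiv ℝ (twistProfile t) x (𝐞 0) 2 = cellAmp t * (-(twistP (x 2) * Real.sin (x 0))) := by
  rw [fderiv_twistProfile_apply, twistDeriv_apply_two, show (𝐞 0) 0 = 1 by simp, show (𝐞 0) 1 = 0 by simp,
    show (𝐞 0) 2 = 0 by simp]
  ring

/-- `∂₁ v₂ = −(−t)^{-1/2} Q sin x₁`. [folklore] -/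
theorem fderiv_twistProfile_e1_apply_two (t : ℝ) (x : E3) :
    fderiv ℝ (twistProfile t) x (𝐞 1) 2 = cellAmp t * (-(twistQ (x 2) * Real.sin (x 1))) := by
  rw [fderiv_twistProfile_apply, twistDeriv_apply_two, show (𝐞 1) 0 = 0 by simp, show (𝐞 1) 1 = 1 by simp,
    show (𝐞 1) 2 = 0 by simp]
  ring

/-- **(TH): PROPORTIONAL SHEAR with a slope depending on HEIGHT ALONE and NOT constant**: `∂₂ v_b = m(x₂) ∂_b v₂` for
`b = 0, 1` at every space–time point, `m = twistSlope`. [folklore] -/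
theorem twistProfile_timeHeightSlope (z : ℝ × EuclideanSpace ℝ (Fin 3)) (b : Fin 3) (hb : b ≠ 2) :
    fderiv ℝ (twistProfile z.1) z.2 (EuclideanSpace.single 2 1) b =
      (fun (_ h : ℝ) => twistSlope h) z.1 (z.2 2) * fderiv ℝ (twistProfile z.1) z.2 (EuclideanSpace.single b 1) 2 := by
  have key0 : fderiv ℝ (twistProfile z.1) z.2 (EuclideanSpace.single 2 1) 0 =
      (fun (_ h : ℝ) => twistSlope h) z.1 (z.2 2) * fderiv ℝ (twistProfile z.1) z.2 (EuclideanSpace.single 0 1) 2 := by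
    rw [fderiv_twistProfile_e2_apply_zero, fderiv_twistProfile_e0_apply_two]
    ring
  have key1 : fderiv ℝ (twistProfile z.1) z.2 (EuclideanSpace.single 2 1) 1 =
      (fun (_ h : ℝ) => twistSlope h) z.1 (z.2 2) * fderiv ℝ (twistProfile z.1) z.2 (EuclideanSpace.single 1 1) 2 := by
    rw [fderiv_twistProfile_e2_apply_one, fderiv_twistProfile_e1_apply_two]
    ring
  fin_cases b
  · exact key0
  · exact key1
  · exact absurd rfl hb

/-- **The vorticity of the twisted column**: `curl v(t) = (−t)^{-1/2} K`, horizontal (poloidal along `e₂`). [folklore] -/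
theorem curl_twistProfile (t : ℝ) (x : E3) : curl (twistProfile t) x = cellAmp t • twistVort x := by
  ext i
  fin_cases i <;>
    simp [curl, twistVort, fderiv_twistProfile, twistDeriv_apply_zero, twistDeriv_apply_one,
      twistDeriv_apply_two] <;> ring

/-- The vorticity slice as a function. [folklore] -/
theorem curl_twistProfile_eq (t : ℝ) : curl (twistProfile t) = fun x => cellAmp t • twistVort x :=
  funext (curl_twistProfile t)

/-- The first component of `curl v(t)(x)`. [folklore] -/
theorem curl_twistProfile_apply_zero (t : ℝ) (x : E3) :
    curl (twistProfile t) x 0 = cellAmp t * ((twistSlope (x 2) - 1) * twistQ (x 2) * Real.sin (x 1)) := by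
  rw [curl_twistProfile]; simp [twistVort]

/-- The second component of `curl v(t)(x)`. [folklore] -/
theorem curl_twistProfile_apply_one (t : ℝ) (x : E3) :
    curl (twistProfile t) x 1 = -(cellAmp t * ((twistSlope (x 2) - 1) * twistP (x 2) * Real.sin (x 0))) := by
  rw [curl_twistProfile]; simp [twistVort]

/-- The third component of `curl v(t)(x)` vanishes (poloidal along `e₂`). [folklore] -/
theorem curl_twistProfile_apply_two (t : ℝ) (x : E3) : curl (twistProfile t) x 2 = 0 := by
  rw [curl_twistProfile]; simp [twistVort]

/-- `D(curl v(t)) = (−t)^{-1/2} DK`. [folklore] -/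
theorem hasFDerivAt_curl_twistProfile (t : ℝ) (x : E3) :
    HasFDerivAt (curl (twistProfile t)) (cellAmp t • twistVortDeriv x) x := by
  rw [curl_twistProfile_eq]
  exact (hasFDerivAt_twistVort x).const_smul (cellAmp t)

/-- `D(curl v(t))(x) w` in coordinates. [folklore] -/
theorem fderiv_curl_twistProfile_apply (t : ℝ) (x w : E3) (i : Fin 3) :
    fderiv ℝ (curl (twistProfile t)) x w i = cellAmp t * twistVortDeriv x w i := by
  rw [(hasFDerivAt_curl_twistProfile t x).fderiv]; rfl

/-- The first component of `D(curl v(t))(x) w`. [folklore] -/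
theorem fderiv_curl_twistProfile_apply_zero (t : ℝ) (x w : E3) :
    fderiv ℝ (curl (twistProfile t)) x w 0 =
      cellAmp t * (((twistSlope (x 2) - 1) * twistQ (x 2)) * (Real.cos (x 1) * w 1) +
        Real.sin (x 1) * (((twistSlope (x 2) - 1) * twistQ₁ (x 2) + twistSlopeD (x 2) * twistQ (x 2)) * w 2)) := by
  rw [fderiv_curl_twistProfile_apply, twistVortDeriv_apply_zero]

/-- The second component of `D(curl v(t))(x) w`. [folklore] -/
theorem fderiv_curl_twistProfile_apply_one (t : ℝ) (x w : E3) :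
    fderiv ℝ (curl (twistProfile t)) x w 1 =
      -(cellAmp t * (((twistSlope (x 2) - 1) * twistP (x 2)) * (Real.cos (x 0) * w 0) +
        Real.sin (x 0) * (((twistSlope (x 2) - 1) * twistP₁ (x 2) + twistSlopeD (x 2) * twistP (x 2)) * w 2))) := by
  rw [fderiv_curl_twistProfile_apply, twistVortDeriv_apply_one, mul_neg]

/-! ## `∂₂v₂` as a differentiable function of the point and the twist bracket -/

/-- `x ↦ ∂₂v₂(t, x)` is differentiable with derivative `twistDzVzDeriv t x`. [folklore] -/
theorem hasFDerivAt_fderiv_twistProfile_e2_two (t : ℝ) (x : E3) :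
    HasFDerivAt (fun y : E3 => fderiv ℝ (twistProfile t) y (𝐞 2) 2) (twistDzVzDeriv t x) x := by
  have e : (fun y : E3 => fderiv ℝ (twistProfile t) y (𝐞 2) 2) =
      fun y => cellAmp t * (twistP₁ (y 2) * Real.cos (y 0) + twistQ₁ (y 2) * Real.cos (y 1)) :=
    funext (fderiv_twistProfile_e2_apply_two t)
  rw [e]
  have h0 : HasFDerivAt (fun y : E3 => y 0) (π 0) x := (π 0).hasFDerivAt
  have h1 : HasFDerivAt (fun y : E3 => y 1) (π 1) x := (π 1).hasFDerivAt
  have h2 : HasFDerivAt (fun y : E3 => y 2) (π 2) x := (π 2).hasFDerivAt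
  have hc0 := (Real.hasDerivAt_cos (x 0)).comp_hasFDerivAt x h0
  have hc1 := (Real.hasDerivAt_cos (x 1)).comp_hasFDerivAt x h1
  have hP1 := (hasDerivAt_twistP₁ (x 2)).comp_hasFDerivAt x h2
  have hQ1 := (hasDerivAt_twistQ₁ (x 2)).comp_hasFDerivAt x h2
  have H := ((hP1.mul hc0).add (hQ1.mul hc1)).const_mul (cellAmp t)
  exact H

/-- `D(∂₂v₂)(t, x) w` in coordinates. [folklore] -/
theorem twistDzVzDeriv_apply (t : ℝ) (x w : E3) : twistDzVzDeriv t x w =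
    cellAmp t * ((twistP₁ (x 2) * (-(Real.sin (x 0)) * w 0) + Real.cos (x 0) * ((twistSlope (x 2) * twistP (x 2)) * w 2)) +
      (twistQ₁ (x 2) * (-(Real.sin (x 1)) * w 1) + Real.cos (x 1) * ((twistSlope (x 2) * twistQ (x 2)) * w 2))) := by
  rfl

/-- `∂₀(∂₂v₂) = −(−t)^{-1/2} P₁ sin x₀`. [folklore] -/
theorem fderiv_fderiv_twistProfile_e2_two_e0 (t : ℝ) (x : E3) :
    fderiv ℝ (fun y : E3 => fderiv ℝ (twistProfile t) y (𝐞 2) 2) x (𝐞 0) =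
      cellAmp t * (-(twistP₁ (x 2) * Real.sin (x 0))) := by
  rw [(hasFDerivAt_fderiv_twistProfile_e2_two t x).fderiv, twistDzVzDeriv_apply, show (𝐞 0) 0 = 1 by simp,
    show (𝐞 0) 1 = 0 by simp, show (𝐞 0) 2 = 0 by simp]
  ring

/-- `∂₁(∂₂v₂) = −(−t)^{-1/2} Q₁ sin x₁`. [folklore] -/
theorem fderiv_fderiv_twistProfile_e2_two_e1 (t : ℝ) (x : E3) :
    fderiv ℝ (fun y : E3 => fderiv ℝ (twistProfile t) y (𝐞 2) 2) x (𝐞 1) =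
      cellAmp t * (-(twistQ₁ (x 2) * Real.sin (x 1))) := by
  rw [(hasFDerivAt_fderiv_twistProfile_e2_two t x).fderiv, twistDzVzDeriv_apply, show (𝐞 1) 0 = 0 by simp,
    show (𝐞 1) 1 = 1 by simp, show (𝐞 1) 2 = 0 by simp]
  ring

/-- **The twisted column is TWISTING**: the twist bracket `∂₀(∂₂v₂)·∂₁v₂ − ∂₁(∂₂v₂)·∂₀v₂` equals
`−(−t)^{-1} sin x₀ sin x₁` at every space–time point (Wronskian `P₁Q − Q₁P = −1`). [folklore] -/
theorem twistProfile_twist (z : ℝ × E3) :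
    fderiv ℝ (fun x => fderiv ℝ (twistProfile z.1) x (𝐞 2) 2) z.2 (𝐞 0) *
          fderiv ℝ (twistProfile z.1) z.2 (𝐞 1) 2 -
        fderiv ℝ (fun x => fderiv ℝ (twistProfile z.1) x (𝐞 2) 2) z.2 (𝐞 1) *
          fderiv ℝ (twistProfile z.1) z.2 (𝐞 0) 2 =
      -(cellAmp z.1 ^ 2 * (Real.sin (z.2 0) * Real.sin (z.2 1))) := by
  rw [fderiv_fderiv_twistProfile_e2_two_e0, fderiv_fderiv_twistProfile_e2_two_e1, fderiv_twistProfile_e0_apply_two,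
    fderiv_twistProfile_e1_apply_two]
  have hw := twistWronskian (z.2 2)
  linear_combination (cellAmp z.1 ^ 2 * (Real.sin (z.2 0) * Real.sin (z.2 1))) * hw

/-! ## The class hypotheses (R), (C), (D), (P) and the frozen constraint (F) -/

/-- `‖v(t)(x)‖ ≤ 10 (−t)^{-1/2}`. [folklore] -/
theorem norm_twistProfile_le (t : ℝ) (x : E3) : ‖twistProfile t x‖ ≤ cellAmp t * 10 := by
  unfold twistProfile
  rw [norm_smul, Real.norm_of_nonneg (cellAmp_nonneg t)]
  exact mul_le_mul_of_nonneg_left (norm_twistField_le x) (cellAmp_nonneg t)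

/-- (R) the Type-I time rate with constant `10`. [folklore] -/
theorem hasTypeITimeDecay_twistProfile : HasTypeITimeDecay 10 twistProfile := by
  intro t _ x
  have h := norm_twistProfile_le t x
  rw [cellAmp] at h
  rw [div_eq_inv_mul]
  exact h

/-- (C) continuity on the open backward slab. [folklore] -/
theorem continuousOn_twistProfile :
    ContinuousOn (Function.uncurry twistProfile) (Set.Iio (0 : ℝ) ×ˢ Set.univ) := by
  have hamp : ContinuousOn (fun z : ℝ × E3 => cellAmp z.1) (Set.Iio (0 : ℝ) ×ˢ Set.univ) := by
    refine ContinuousOn.inv₀ ?_ fun z hz => (Real.sqrt_pos.2 (neg_pos.2 (show z.1 < 0 from hz.1))).ne'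
    exact ((Real.continuous_sqrt.comp continuous_neg).comp continuous_fst).continuousOn
  exact hamp.smul (continuous_twistField.comp continuous_snd).continuousOn

/-- (D) divergence-free slices: `div V = −P₁ cos x₀ − Q₁ cos x₁ + (P₁ cos x₀ + Q₁ cos x₁) = 0`. [folklore] -/
theorem isDivFree_twistProfile (t : ℝ) : VectorCalculus.IsDivFree (twistProfile t) := by
  intro y
  rw [divergence_eq_sum_inner_fderiv (EuclideanSpace.basisFun (Fin 3) ℝ), Fin.sum_univ_three]
  simp only [EuclideanSpace.basisFun_apply, EuclideanSpace.inner_single_left, map_one, one_mul,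
    fderiv_twistProfile_apply, twistDeriv_apply_zero, twistDeriv_apply_one, twistDeriv_apply_two, PiLp.single_apply]
  simp
  ring

/-- (P) poloidal along `e₂` everywhere on every slice. [folklore] -/
theorem poloidal_twistProfile (s : ℝ) (y : E3) : ⟪curl (twistProfile s) y, (𝐞 2)⟫_ℝ = 0 := by
  rw [EuclideanSpace.inner_single_right, curl_twistProfile_apply_two]
  simp

/-- (F) the frozen constraint `⟪Dv(s)(y) curl v(s)(y), e₂⟫ = 0` (`v·e₂`'s horizontal gradient is `⊥` to the horizontal
vorticity: `(−P sin x₀)(m−1)Q sin x₁ + (−Q sin x₁)(−(m−1)P sin x₀) = 0`). [folklore] -/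
theorem frozen_twistProfile (s : ℝ) (y : E3) :
    ⟪fderiv ℝ (twistProfile s) y (curl (twistProfile s) y), (𝐞 2)⟫_ℝ = 0 := by
  rw [EuclideanSpace.inner_single_right, fderiv_twistProfile_apply, twistDeriv_apply_two,
    curl_twistProfile_apply_zero, curl_twistProfile_apply_one, curl_twistProfile_apply_two, RCLike.conj_to_real]
  ring

end Summit.NavierStokesRegularity.NavierStokesRegularity.Theorems.LrcModEntire.Negative

end
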